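/-
Copyright: the b2b-balaban T⁴-continuum CRUX team, row NE7b, leaf lineage `t4-ne7b-formalise-leaf-02` (gen 132). Project licence.
-/
import Literature.MathematicalPhysics.QuantumFieldTheory.Balaban1983to89.T4TermwiseTorus

/-!
# THE `ℤ^d → (ℤ∕N)^d` RE-INDEXING OF THE BLOCK SQUARE: the `ℤ^d`-parametrised sums of the `k = 1` letter (curls at `x + ie_κ + je_μ`,
# the 1-form on the interior rows, the left column and two far sides) read as sums over the torus Finsets `Sq`, `Gr ∪ Bd` of the counting
# files — class arithmetic `tcls`, injectivity of the parametrisations for `L ≤ N`, and the five comparison lemmas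
# (row NE7b, node U5c; `HOME/b2b-balaban-r1/SectE-interface-proof.md` §5.2 (5.2); E-side key reading: the periodisation junction between
# `…OneStepCoarseCurlBound` (on `ℤ^d`, [B7]'s lattice) and `…BlockSquareCounting` (on the two-scale torus))

Cell `pub-balaban`, sub-cell `t4`, spine estimate NE7b (`T4WeightBudget.RelWeightBound`; the cell's OWN estimate — NOT PRINTED in
[Bałaban 1983–89], NOT PROVED).  Crux-route work under `Spine/NE7b/` by the row's E-side ∕ key-readings ∕ lattice-geometry leaf lineage;
[folklore] finite sums; NOTHING of Bałaban's is asserted; no `T4Continuum/Support` leaf typed; no `def`, no notation (the torus Finsets `Sq`, `Bd`,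
`Gr` are carried by the characterising hypotheses of `…BlockSurfaceMultiplicity` ∕ `…BlockSquareRowMultiplicity`, verbatim); zero `sorry`.
Imports: `Literature.….T4TermwiseTorus` (the torus class `tcls`, [Balaban1987RG1] (0.1); through it `B7Prop1Explicit.Site ∕ e ∕ boxVec`).

WHY (located).  [B7]'s objects — and so the `k = 1` letter `…OneStepCoarseCurlBound.norm_coarseCurl_Q0cov_bavg_le_curls` — live on `ℤ^d`
and come as sums over `i, j < L` of quantities at the lattice points `x_r + ie_κ + je_μ`; the counting `…BlockSquareCounting.sum_sq_le_twoScale_rows`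
lives on the torus `(ℤ∕LM)^d` and wants sums over the image Finsets `Sq x̄ a` (the `L²` plaquettes of the based square) and `Gr x̄ a ∪ Bd x̄ a` (its
`2L²` interior and `4L` boundary bonds).  For periodic data the summands depend only on the class `tcls N (·)`; THIS FILE supplies the
bookkeeping between the two indexings: `tcls N (x + ie_κ) = tcls N x + Pi.single κ i`, the block point `tcls N (L·y + r) = (val y)·L + r`,
injectivity of `i ↦ x̄ + ie_κ` and `(i, j) ↦ x̄ + ie_κ + je_μ` on `Fin L` when `L ≤ N`, and the resulting equalities ∕ inequalities of sums.

WHAT IS PROVED ([folklore]; `N, L : ℕ`, `L ≤ N` where injectivity is used; `a : {a : Fin d × Fin d ∕∕ a.1 < a.2}`, `κ = a.1.1`, `μ = a.1.2`):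
* §1 `tcls_add_natMul_e` (`tcls N (x + (i:ℤ)•e_ν) = tcls N x + Pi.single ν (i : ZMod N)`), `tcls_blockBase_add_boxVec` (the block point of
  `…BlockSurfaceMultiplicity` §4 is the class of `L·val(y) + boxVec r`).
* §2 `line_injective` (`i ↦ x̄ + Pi.single ν i` on `Fin L`), `square_injective` (`(i, j) ↦ x̄ + Pi.single κ i + Pi.single μ j`, `κ ≠ μ`).
* §3 `sum_image_le_of_subset` (generic: an injective family inside a Finset sums below the Finset, nonnegative summand);
  **`sum_sq_tcls_eq_sum_Sq`** (`Σ_{j<L}Σ_{i<L} h(tcls N (x+ie_κ+je_μ), a) = Σ_{q∈Sq (tcls N x) a} h q`); **`sum_col_tcls_le`**, **`sum_farμ_tcls_le`**,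
  **`sum_farκ_tcls_le`**, **`sum_rows_tcls_le`** — the left column `(x+ie_μ; μ)`, the far sides `(x+Le_κ+ie_μ; μ)`, `(x+Le_μ+ie_κ; κ)` and the interior
  rows `(x+je_μ+ie_κ; κ)` each sum (nonnegative summand) below `Σ_{b ∈ Gr (tcls N x) a ∪ Bd (tcls N x) a}`.

NOT HERE (honest): periodicity itself (`T4TermwiseTorus.IsPeriodic`, `B7AvgPeriodicity`), the junction, anything of Bałaban's.  BY-NAME EFFECT ON
THE WALL: NONE.  NE7b NOT PRINTED ∕ NOT PROVED; spine PROVED 0∕9; rung (B)+1 on a FINITE torus — NOT infinite volume, NOT the mass gap, NOT Clay.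
HONEST DEPENDENCY: continuum YM on T⁴ ⇐ BetaPertH ∧ nine spine estimates (0/9 proved); BetaPertH ⇐ (D1) ∧ (D4) ∧ CAP+tail.
-/

set_option autoImplicit false

open scoped BigOperators
open Finset
open Literature.MathematicalPhysics.QuantumFieldTheory.Balaban1983to89.B7Prop1Explicit (Site e e_apply boxVec)
open Literature.MathematicalPhysics.QuantumFieldTheory.Balaban1983to89.T4TermwiseTorus (tcls tcls_apply tcls_add)

namespace Summit.QuantumFields.BalabanUV.T4Continuum.NE7b.TorusSquareReindexing

variable {d : ℕ} (N L : ℕ)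

/-! ## §1 Class arithmetic -/

/-- `tcls N (x + i•e_ν) = tcls N x + Pi.single ν i` (`i : ℕ`). [folklore] -/
theorem tcls_add_natMul_e (x : Site d) (ν : Fin d) (i : ℕ) :
    tcls N (x + (i : ℤ) • e ν) = tcls N x + Pi.single ν ((i : ℕ) : ZMod N) := by
  funext ι
  simp only [tcls_apply, Pi.add_apply, Pi.smul_apply, e_apply, smul_eq_mul, Pi.single_apply]
  split_ifs with h <;> simp

/-- The block point of `…BlockSurfaceMultiplicity` §4, `i ↦ (val(y_i)·L + r_i : ZMod (L·M))`, is the class of the `ℤ^d` point `L·val(y) + boxVec r`.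
[folklore] -/
theorem tcls_blockBase_add_boxVec {M : ℕ} (y : Fin d → ZMod M) (r : Fin d → Fin L) :
    tcls (L * M) ((fun i => (L : ℤ) * ((y i).val : ℤ)) + boxVec L r)
      = fun i => ((((y i).val * L + (r i : ℕ) : ℕ)) : ZMod (L * M)) := by
  funext i
  simp only [tcls_apply, Pi.add_apply, boxVec]
  push_cast
  ring

/-! ## §2 Injectivity of the parametrisations on `Fin L`, `L ≤ N` -/

/-- `i ↦ (i : ZMod N)` is injective on `Fin L` when `L ≤ N`. [folklore] -/
theorem natCast_zmod_injective (hLN : L ≤ N) : Function.Injective (fun i : Fin L => ((i : ℕ) : ZMod N)) := by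
  intro i j h
  have h' := congrArg ZMod.val h
  simp only [ZMod.val_natCast, Nat.mod_eq_of_lt (lt_of_lt_of_le i.isLt hLN), Nat.mod_eq_of_lt (lt_of_lt_of_le j.isLt hLN)] at h'
  exact Fin.ext h'

/-- The line `i ↦ x̄ + Pi.single ν i` is injective on `Fin L` (`L ≤ N`). [folklore] -/
theorem line_injective (hLN : L ≤ N) (xb : Fin d → ZMod N) (ν : Fin d) :
    Function.Injective (fun i : Fin L => xb + Pi.single ν (((i : ℕ) : ZMod N))) := by
  intro i j h
  have h' := congrFun h ν
  simp only [Pi.add_apply, Pi.single_eq_same, add_right_inj] at h'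
  exact natCast_zmod_injective N L hLN h'

/-- The square `(i, j) ↦ x̄ + Pi.single κ i + Pi.single μ j` is injective on `Fin L × Fin L` (`κ ≠ μ`, `L ≤ N`). [folklore] -/
theorem square_injective (hLN : L ≤ N) (xb : Fin d → ZMod N) {κ μ : Fin d} (hκμ : κ ≠ μ) :
    Function.Injective (fun ij : Fin L × Fin L =>
      xb + Pi.single κ (((ij.1 : ℕ) : ZMod N)) + Pi.single μ (((ij.2 : ℕ) : ZMod N))) := by
  rintro ⟨i, j⟩ ⟨i', j'⟩ h
  have hκ := congrFun h κ
  have hμ := congrFun h μ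
  simp only [Pi.add_apply, Pi.single_eq_same, Pi.single_eq_of_ne hκμ, Pi.single_eq_of_ne (Ne.symm hκμ), add_zero,
    add_right_inj] at hκ hμ
  have hκ' : xb κ + ((i : ℕ) : ZMod N) = xb κ + ((i' : ℕ) : ZMod N) := by simpa using hκ
  exact Prod.ext (natCast_zmod_injective N L hLN (add_left_cancel hκ')) (natCast_zmod_injective N L hLN hμ)

/-! ## §3 The comparison of sums -/

/-- Generic: an injective family `f` on `s` with image inside `T` sums a nonnegative `g` below `Σ_{b∈T} g b`. [folklore] -/
theorem sum_image_le_of_subset {ι β : Type*} [DecidableEq β] (s : Finset ι) (f : ι → β) (hf : Set.InjOn f s)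
    (T : Finset β) (hT : ∀ i ∈ s, f i ∈ T) (g : β → ℝ) (hg : ∀ b ∈ T, 0 ≤ g b) :
    ∑ i ∈ s, g (f i) ≤ ∑ b ∈ T, g b := by
  rw [← Finset.sum_image hf]
  refine Finset.sum_le_sum_of_subset_of_nonneg (fun b hb => ?_) (fun b hb _ => hg b hb)
  obtain ⟨i, hi, rfl⟩ := Finset.mem_image.1 hb
  exact hT i hi

variable (Sq : (Fin d → ZMod N) → {a : Fin d × Fin d // a.1 < a.2} → Finset ((Fin d → ZMod N) × {a : Fin d × Fin d // a.1 < a.2}))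
  (hSq : ∀ x a, Sq x a = univ.image (fun ij : Fin L × Fin L =>
    (x + Pi.single a.1.1 ((ij.1 : ℕ) : ZMod N) + Pi.single a.1.2 ((ij.2 : ℕ) : ZMod N), a)))
  (Bd : (Fin d → ZMod N) → {a : Fin d × Fin d // a.1 < a.2} → Finset ((Fin d → ZMod N) × Fin d))
  (hBd : ∀ x a, Bd x a = univ.image (fun csi : Bool × Bool × Fin L =>
      if csi.1 then
        (if csi.2.1 then x + Pi.single a.1.1 ((csi.2.2 : ℕ) : ZMod N)
          else x + Pi.single a.1.2 (L : ZMod N) + Pi.single a.1.1 ((csi.2.2 : ℕ) : ZMod N), a.1.1)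
      else
        (if csi.2.1 then x + Pi.single a.1.2 ((csi.2.2 : ℕ) : ZMod N)
          else x + Pi.single a.1.1 (L : ZMod N) + Pi.single a.1.2 ((csi.2.2 : ℕ) : ZMod N), a.1.2)))
  (Gr : (Fin d → ZMod N) → {a : Fin d × Fin d // a.1 < a.2} → Finset ((Fin d → ZMod N) × Fin d))
  (hGr : ∀ x a, Gr x a = univ.image (fun cij : Bool × Fin L × Fin L =>
      (x + Pi.single a.1.1 ((cij.2.1 : ℕ) : ZMod N) + Pi.single a.1.2 ((cij.2.2 : ℕ) : ZMod N),
        if cij.1 then a.1.1 else a.1.2)))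

include hSq in
/-- **THE CURLS**: `Σ_{j<L}Σ_{i<L} h(tcls N (x + ie_κ + je_μ), a) = Σ_{q∈Sq (tcls N x) a} h q` (`κ = a.1.1 ≠ μ = a.1.2`, `L ≤ N`). [folklore] -/
theorem sum_sq_tcls_eq_sum_Sq (hLN : L ≤ N) (x : Site d) (a : {a : Fin d × Fin d // a.1 < a.2})
    (h : (Fin d → ZMod N) × {a : Fin d × Fin d // a.1 < a.2} → ℝ) :
    ∑ j ∈ Finset.range L, ∑ i ∈ Finset.range L, h (tcls N (x + (i : ℤ) • e a.1.1 + (j : ℤ) • e a.1.2), a)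
      = ∑ q ∈ Sq (tcls N x) a, h q := by
  classical
  have hne : a.1.1 ≠ a.1.2 := ne_of_lt a.2
  rw [hSq, Finset.sum_image (fun ij _ ij' _ hh => square_injective N L hLN (tcls N x) hne (by
      have := congrArg Prod.fst hh; exact this))]
  rw [Finset.sum_comm, Finset.sum_range (fun i => ∑ j ∈ Finset.range L, h (tcls N (x + (i : ℤ) • e a.1.1 + (j : ℤ) • e a.1.2), a)),
    ← Finset.univ_product_univ, Finset.sum_product]
  refine Finset.sum_congr rfl fun i _ => ?_
  rw [Finset.sum_range (fun j => h (tcls N (x + (i : ℤ) • e a.1.1 + (j : ℤ) • e a.1.2), a))]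
  refine Finset.sum_congr rfl fun j _ => ?_
  rw [tcls_add_natMul_e, tcls_add_natMul_e]

include hBd in
/-- **THE LEFT COLUMN** `(x + ie_μ; μ)`, `i < L`, sums below `Gr ∪ Bd` (it lies in `Bd`). [folklore] -/
theorem sum_col_tcls_le (hLN : L ≤ N) (x : Site d) (a : {a : Fin d × Fin d // a.1 < a.2})
    (g : (Fin d → ZMod N) × Fin d → ℝ) (hg : ∀ b, 0 ≤ g b) :
    ∑ i ∈ Finset.range L, g (tcls N (x + (i : ℤ) • e a.1.2), a.1.2)
      ≤ ∑ b ∈ Gr (tcls N x) a ∪ Bd (tcls N x) a, g b := by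
  classical
  rw [Finset.sum_range (fun i => g (tcls N (x + (i : ℤ) • e a.1.2), a.1.2))]
  simp_rw [tcls_add_natMul_e]
  refine sum_image_le_of_subset univ (fun i : Fin L => (tcls N x + Pi.single a.1.2 (((i : ℕ) : ZMod N)), a.1.2))
    (fun i _ j _ hh => line_injective N L hLN (tcls N x) a.1.2 (congrArg Prod.fst hh)) _ (fun i _ => ?_) g (fun b _ => hg b)
  refine Finset.mem_union_right _ ?_
  rw [hBd]
  exact Finset.mem_image.2 ⟨(false, true, i), Finset.mem_univ _, by simp⟩

include hBd in
/-- **THE FAR `μ`-SIDE** `(x + Le_κ + ie_μ; μ)`, `i < L`, sums below `Gr ∪ Bd` (it lies in `Bd`). [folklore] -/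
theorem sum_farμ_tcls_le (hLN : L ≤ N) (x : Site d) (a : {a : Fin d × Fin d // a.1 < a.2})
    (g : (Fin d → ZMod N) × Fin d → ℝ) (hg : ∀ b, 0 ≤ g b) :
    ∑ i ∈ Finset.range L, g (tcls N (x + (L : ℤ) • e a.1.1 + (i : ℤ) • e a.1.2), a.1.2)
      ≤ ∑ b ∈ Gr (tcls N x) a ∪ Bd (tcls N x) a, g b := by
  classical
  rw [Finset.sum_range (fun i => g (tcls N (x + (L : ℤ) • e a.1.1 + (i : ℤ) • e a.1.2), a.1.2))]
  simp_rw [tcls_add_natMul_e]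
  refine sum_image_le_of_subset univ
    (fun i : Fin L => (tcls N x + Pi.single a.1.1 (((L : ℕ) : ZMod N)) + Pi.single a.1.2 (((i : ℕ) : ZMod N)), a.1.2))
    (fun i _ j _ hh => line_injective N L hLN (tcls N x + Pi.single a.1.1 (((L : ℕ) : ZMod N))) a.1.2 (congrArg Prod.fst hh)) _
    (fun i _ => ?_) g (fun b _ => hg b)
  refine Finset.mem_union_right _ ?_
  rw [hBd]
  exact Finset.mem_image.2 ⟨(false, false, i), Finset.mem_univ _, by simp⟩

include hBd in
/-- **THE FAR `κ`-SIDE** `(x + Le_μ + ie_κ; κ)`, `i < L`, sums below `Gr ∪ Bd` (it lies in `Bd`). [folklore] -/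
theorem sum_farκ_tcls_le (hLN : L ≤ N) (x : Site d) (a : {a : Fin d × Fin d // a.1 < a.2})
    (g : (Fin d → ZMod N) × Fin d → ℝ) (hg : ∀ b, 0 ≤ g b) :
    ∑ i ∈ Finset.range L, g (tcls N (x + (L : ℤ) • e a.1.2 + (i : ℤ) • e a.1.1), a.1.1)
      ≤ ∑ b ∈ Gr (tcls N x) a ∪ Bd (tcls N x) a, g b := by
  classical
  rw [Finset.sum_range (fun i => g (tcls N (x + (L : ℤ) • e a.1.2 + (i : ℤ) • e a.1.1), a.1.1))]
  simp_rw [tcls_add_natMul_e]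
  refine sum_image_le_of_subset univ
    (fun i : Fin L => (tcls N x + Pi.single a.1.2 (((L : ℕ) : ZMod N)) + Pi.single a.1.1 (((i : ℕ) : ZMod N)), a.1.1))
    (fun i _ j _ hh => line_injective N L hLN (tcls N x + Pi.single a.1.2 (((L : ℕ) : ZMod N))) a.1.1 (congrArg Prod.fst hh)) _
    (fun i _ => ?_) g (fun b _ => hg b)
  refine Finset.mem_union_right _ ?_
  rw [hBd]
  exact Finset.mem_image.2 ⟨(true, false, i), Finset.mem_univ _, by simp⟩

include hGr in
/-- **THE INTERIOR ROWS** `(x + je_μ + ie_κ; κ)`, `i, j < L`, sum below `Gr ∪ Bd` (they lie in `Gr`). [folklore] -/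
theorem sum_rows_tcls_le (hLN : L ≤ N) (x : Site d) (a : {a : Fin d × Fin d // a.1 < a.2})
    (g : (Fin d → ZMod N) × Fin d → ℝ) (hg : ∀ b, 0 ≤ g b) :
    ∑ j ∈ Finset.range L, ∑ i ∈ Finset.range L, g (tcls N (x + (j : ℤ) • e a.1.2 + (i : ℤ) • e a.1.1), a.1.1)
      ≤ ∑ b ∈ Gr (tcls N x) a ∪ Bd (tcls N x) a, g b := by
  classical
  have hne : a.1.1 ≠ a.1.2 := ne_of_lt a.2
  have hpt : ∀ i j : ℕ, tcls N (x + (j : ℤ) • e a.1.2 + (i : ℤ) • e a.1.1)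
      = tcls N x + Pi.single a.1.1 (((i : ℕ) : ZMod N)) + Pi.single a.1.2 (((j : ℕ) : ZMod N)) := fun i j => by
    rw [tcls_add_natMul_e, tcls_add_natMul_e, add_right_comm]
  calc ∑ j ∈ Finset.range L, ∑ i ∈ Finset.range L, g (tcls N (x + (j : ℤ) • e a.1.2 + (i : ℤ) • e a.1.1), a.1.1)
      = ∑ i : Fin L, ∑ j : Fin L,
          g (tcls N x + Pi.single a.1.1 ((((i : ℕ) : ℕ) : ZMod N)) + Pi.single a.1.2 ((((j : ℕ) : ℕ) : ZMod N)), a.1.1) := by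
        rw [Finset.sum_comm, Finset.sum_range (fun i => ∑ j ∈ Finset.range L,
          g (tcls N (x + (j : ℤ) • e a.1.2 + (i : ℤ) • e a.1.1), a.1.1))]
        refine Finset.sum_congr rfl fun i _ => ?_
        rw [Finset.sum_range (fun j => g (tcls N (x + (j : ℤ) • e a.1.2 + ((i : ℕ) : ℤ) • e a.1.1), a.1.1))]
        refine Finset.sum_congr rfl fun j _ => ?_
        rw [hpt]
    _ = ∑ ij ∈ (univ : Finset (Fin L)) ×ˢ (univ : Finset (Fin L)),
          g (tcls N x + Pi.single a.1.1 ((((ij.1 : ℕ) : ℕ) : ZMod N)) + Pi.single a.1.2 ((((ij.2 : ℕ) : ℕ) : ZMod N)), a.1.1) :=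
        (Finset.sum_product' _ _ _).symm
    _ ≤ ∑ b ∈ Gr (tcls N x) a ∪ Bd (tcls N x) a, g b := by
        refine sum_image_le_of_subset _
          (fun ij : Fin L × Fin L =>
            (tcls N x + Pi.single a.1.1 (((ij.1 : ℕ) : ZMod N)) + Pi.single a.1.2 (((ij.2 : ℕ) : ZMod N)), a.1.1))
          (fun ij _ ij' _ hh => square_injective N L hLN (tcls N x) hne (congrArg Prod.fst hh)) _ (fun ij _ => ?_) g
          (fun b _ => hg b)
        refine Finset.mem_union_left _ ?_
        rw [hGr]
        exact Finset.mem_image.2 ⟨(true, ij.1, ij.2), Finset.mem_univ _, by simp⟩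

end Summit.QuantumFields.BalabanUV.T4Continuum.NE7b.TorusSquareReindexing
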